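import Summits.AnomalousDissipation.AnomalousDissipation.Theses.SawtoothPulseCascade
import Summits.AnomalousDissipation.AnomalousDissipation.Theorems.SawtoothPulseCascadeK3LocalisedClosureDriftFreeClosure

/-!
# `SawtoothPulseCascade.DriftFreeClosure58` (stmt-AnomalousDissipation-19689) — by name

Route `AnomalousDissipation/SawtoothPulseCascade`, rev 11/12 (2026-08-26): the crux `K3LocalisedClosure`
(stmt-AnomalousDissipation-19492, `K1LocalisedCascade → K2LinearisedCascadeGrowth → Target`) was SPLIT ×3
along the lead prover's registered line `Cruxes.K3LocalisedClosure.DriftFree` (skeleton v3.2, sha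
`ced323057a45`) into `Packaging58 → ApproxSol58 → DriftFreeClosure58 → K3LocalisedClosure`
(glue item `K3LocalisedClosureGlue`, stmt-AnomalousDissipation-19690).

The third child, the support item `DriftFreeClosure58`, is VERBATIM the signature of the registered stub
`stub_driftFreeClosure` of that line, which is already a theorem of the tree:
`Summit.AnomalousDissipation.AnomalousDissipation.Theorems.SawtoothPulseCascade.DriftFreeClosure.stub_driftFreeClosure`
(`Theorems/SawtoothPulseCascadeK3LocalisedClosureDriftFreeClosure.lean`, p444010) — the drift-free closure
(Johansson–Sorella, Lemma 2.2 bookkeeping; no balanced growth, no duality): on the strain box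
`γ ∈ [5, 8]`, `ρN ∈ {2, …, 7}` the localised scalar crux `K1LocalisedCascade`, the existence package
`DriftFree.Existence` and the Grenier approximate solutions `DriftFree.ApproximateSolution … (γ² − 3)` give the
planar anomalous family `DriftFree.PlanarAnomalousFamily` at every box point (NS energy stability
`DriftFree.nsEnergyStability` ⇒ `∫‖V_ν − U‖² ≲ εν`; drift-free scalar comparison ⇒ `‖θ^V(T) − θ̄(T)‖² ≤ 4ε`;
K1loc's fraction `χ` ⇒ `2ν ∫₀ᵀ ‖∇θ^V‖² ≥ (5χ/12) ‖θ₀‖²`; the lift's dissipation dominates the scalar's and is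
integrable to `t = 1` by the force bound).  This file only records the item under the route's decl so that
the ledger credits it; the closing theorem is a one-line citation.
-/

-- `Summit.<Summit>.<Problem>` is the tree's mandated summit-side namespace (CONVENTIONS §2); for this
-- single-conjunct summit the two coincide, so the duplicate is deliberate (lakefile: off for `Summits`).
set_option linter.dupNamespace false

namespace Summit.AnomalousDissipation.AnomalousDissipation.Theorems.SawtoothPulseCascade

/-- Closes the route support item `DriftFreeClosure58` (stmt-AnomalousDissipation-19689, child of the split
crux `K3LocalisedClosure`): `K1LocalisedCascade →` (existence package on the box) `→` (approximate solutions
at rate `γ² − 3` on the box) `→` the planar anomalous family `DriftFree.PlanarAnomalousFamily ⟨γ, ¼, 2, 1, ρN⟩`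
for every `γ ∈ [5, 8]`, `ρN ∈ {2, …, 7}` — by the landed theorem
`Theorems.SawtoothPulseCascade.DriftFreeClosure.stub_driftFreeClosure` (p444010). -/
theorem driftFreeClosure58_proof :
    Summit.AnomalousDissipation.AnomalousDissipation.Theses.SawtoothPulseCascade.DriftFreeClosure58 :=
  Summit.AnomalousDissipation.AnomalousDissipation.Theorems.SawtoothPulseCascade.DriftFreeClosure.stub_driftFreeClosure

end Summit.AnomalousDissipation.AnomalousDissipation.Theorems.SawtoothPulseCascade
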